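import Summits.ValiantsHypothesis.ValiantsHypothesis.Theorems.KPlusLogSqLawTropicalBMarkedEdgeCoreZUnique

/-!
# Route «KPlusLogSqLaw», crux `TropicalB` (stmt-ValiantsHypothesis-19771) — MARKED-EDGE sector, NESTED-TRIANGLE CORE, ALL sizes, part 5:
# b4-RIGIDITY — inside `σX ⊎ σY ⊎ σZ`, a cover using the loop at `b4` but not the loop at `b0` carries (almost) no triangle loop

HONEST FRAMING.  Helper file (cell `pub-symmetroid`, seat val-sym-trop-p4 (g18), 2026-08-28; `--supports stmt-ValiantsHypothesis-19771 --as
helper`).  Continues parts 1–4 (`…MarkedEdgeCorePairs`, `…CoreZPairs`, `…CoreZUnique`, `…CoreTriangle`): all-`m` structure of a would-be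
realisation of the nested-triangle core {1,2},{1,3},{2,3},{0,4} (kernel-impossible at m = 6, p664896; located-exact impossible m ≤ 8; OPEN for
m ≥ 9).  THIS PART is the all-`m` content of the second family of three-body Karamata certificates of the lineage (g17 memo §2 / this seat's
adversarial census: types (1,2,30), (0,3,30), (2,11,20), (0,11,22), (0,7,26), (2,7,24), (0,15,24), (4,13,18), …): a cover `T` inside a triple union
containing `σZ` that uses the loop at `b4` but NOT the loop at `b0`.  RESULTS (`T i ∈ {σX i, σY i, σZ i}` for all `i`, `T b4 = b4`, `T b0 ≠ b0`):
* `core_CEZ_four`: in `σC ⊎ σE ⊎ σZ`, `T` uses none of the loops `b1, b2, b3` (pattern `{b4}`);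
* `core_BEZ_four`: in `σB ⊎ σE ⊎ σZ`, `T` uses neither `b1` nor `b3` (pattern ⊆ `{b2, b4}`);
* `core_BCZ_four`: in `σB ⊎ σC ⊎ σZ`, `T` uses neither `b2` nor `b3` (pattern ⊆ `{b1, b4}`).
(The patterns `{b4}`, `{b2,b4}`, `{b1,b4}` left open are exactly the mixed covers of the split case of part 2 and the «conditional»
certificates whose Hall completion is parity-dependent.)  Proof: Hall completion `(T, M₂, M₃)` (`FourBit.two_factor`); `T` has slope ≥ 17; if both
`M`'s were above the slope of `σX` their loop shapes would over-use a loop of multiplicity one (`b0`, `b1`, `b2` or `b3`) — multiplicity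
bookkeeping in the pointwise factorisation; so one `M` is low and `FourBit.factors_eq` forces `T = σZ`, contradicting `T b0 ≠ b0`.
Nothing here proves the law; nothing concerns `TropicalB` in its window, `WeakLifting`, the doors, `MatrixDescartes` (stmt-ValiantsHypothesis-
18050) or VP ≠ VNP.
-/

set_option linter.dupNamespace false
set_option autoImplicit false

namespace Summit.ValiantsHypothesis.ValiantsHypothesis.Theorems.KPlusLogSqLaw
namespace MarkedEdge
namespace Core

open Finset

variable {V : Type*} [Fintype V] [DecidableEq V]

omit [Fintype V] in
/-- multiplicity ≤ 1: in a pointwise factorisation `[t, x, y] ~ l` with `l.count v ≤ 1`, at most one of `t, x, y` equals `v`. [folklore] -/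
theorem excl_of_count_le_one {t x y v : V} {l : List V} (h : List.Perm [t, x, y] l) (hc : l.count v ≤ 1) :
    (t = v → x ≠ v ∧ y ≠ v) ∧ (x = v → y ≠ v) := by
  have hc' := h.count_eq v
  by_cases ht : t = v <;> by_cases hx : x = v <;> by_cases hy : y = v <;> simp [ht, hx, hy] at hc' ⊢ <;> omega

omit [Fintype V] in
/-- multiplicity ≤ 2: not all three of `t, x, y` equal `v`. [folklore] -/
theorem not_all_of_count_le_two {t x y v : V} {l : List V} (h : List.Perm [t, x, y] l) (hc : l.count v ≤ 2) :
    ¬ (t = v ∧ x = v ∧ y = v) := by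
  have hc' := h.count_eq v
  rintro ⟨ht, hx, hy⟩
  simp [ht, hx, hy] at hc'
  omega

section Core

variable (ok : V → V → Prop) (w g : V → V → ℤ) (b : Fin 5 → V)

/-- a cover using the loop at `b4` and one triangle loop has slope at least 17. [folklore] -/
theorem seventeen_le_slope_of_four (hb : Function.Injective b)
    (hoff : ∀ i j, j ≠ i → g i j = 0) (hmark : ∀ l, g (b l) (b l) = (2 : ℤ) ^ (l : ℕ)) (haux : ∀ i, (∀ l, b l ≠ i) → g i i = 0)
    (T : Equiv.Perm V) (hT4 : T (b 4) = b 4) (hT : T (b 1) = b 1 ∨ T (b 2) = b 2 ∨ T (b 3) = b 3) : 17 ≤ ∑ i, g i (T i) := by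
  rw [slope_eq_sum_marked g b hb hoff hmark haux T, Fin.sum_univ_five]
  by_cases c0 : T (b 0) = b 0 <;> by_cases c1 : T (b 1) = b 1 <;> by_cases c2 : T (b 2) = b 2 <;> by_cases c3 : T (b 3) = b 3 <;>
    simp [hT4, c0, c1, c2, c3] at hT ⊢

/-- loop shape of a cover without `b4` whose slope exceeds 10: it uses `b3`, and `b2` or both `b1, b0`. [folklore] -/
theorem shape_of_slope_gt_ten (hb : Function.Injective b)
    (hoff : ∀ i j, j ≠ i → g i j = 0) (hmark : ∀ l, g (b l) (b l) = (2 : ℤ) ^ (l : ℕ)) (haux : ∀ i, (∀ l, b l ≠ i) → g i i = 0)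
    (M : Equiv.Perm V) (hM4 : M (b 4) ≠ b 4) (hs : 10 < ∑ i, g i (M i)) :
    M (b 3) = b 3 ∧ (M (b 2) = b 2 ∨ (M (b 1) = b 1 ∧ M (b 0) = b 0)) := by
  rw [slope_eq_sum_marked g b hb hoff hmark haux M, Fin.sum_univ_five] at hs
  by_cases c0 : M (b 0) = b 0 <;> by_cases c1 : M (b 1) = b 1 <;> by_cases c2 : M (b 2) = b 2 <;> by_cases c3 : M (b 3) = b 3 <;>
    simp [hM4, c0, c1, c2, c3] at hs ⊢

/-- loop shape of a cover without `b4` whose slope exceeds 6: it uses `b3`, or all of `b0, b1, b2`. [folklore] -/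
theorem shape_of_slope_gt_six (hb : Function.Injective b)
    (hoff : ∀ i j, j ≠ i → g i j = 0) (hmark : ∀ l, g (b l) (b l) = (2 : ℤ) ^ (l : ℕ)) (haux : ∀ i, (∀ l, b l ≠ i) → g i i = 0)
    (M : Equiv.Perm V) (hM4 : M (b 4) ≠ b 4) (hs : 6 < ∑ i, g i (M i)) :
    M (b 3) = b 3 ∨ (M (b 0) = b 0 ∧ M (b 1) = b 1 ∧ M (b 2) = b 2) := by
  rw [slope_eq_sum_marked g b hb hoff hmark haux M, Fin.sum_univ_five] at hs
  by_cases c0 : M (b 0) = b 0 <;> by_cases c1 : M (b 1) = b 1 <;> by_cases c2 : M (b 2) = b 2 <;> by_cases c3 : M (b 3) = b 3 <;>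
    simp [hM4, c0, c1, c2, c3] at hs ⊢

/-- **b4-RIGIDITY in `σC ⊎ σE ⊎ σZ`.**  A cover inside the arcs of `σC, σE, σZ` that uses the loop at `b4` but not the loop at `b0` uses no
triangle loop. [this seat's lemma] -/
theorem core_CEZ_four (hb : Function.Injective b)
    (hoff : ∀ i j, j ≠ i → g i j = 0) (hmark : ∀ l, g (b l) (b l) = (2 : ℤ) ^ (l : ℕ)) (haux : ∀ i, (∀ l, b l ≠ i) → g i i = 0)
    {θC θE θZ : ℤ} {σC σE σZ : Equiv.Perm V} (hCE : θC < θE) (hEZ : θE < θZ)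
    (hC : (∀ i, ok i (σC i)) ∧ ∀ τ : Equiv.Perm V, τ ≠ σC → (∀ i, ok i (τ i)) →
      ∑ i, (w i (τ i) + θC * g i (τ i)) < ∑ i, (w i (σC i) + θC * g i (σC i)))
    (hE : (∀ i, ok i (σE i)) ∧ ∀ τ : Equiv.Perm V, τ ≠ σE → (∀ i, ok i (τ i)) →
      ∑ i, (w i (τ i) + θE * g i (τ i)) < ∑ i, (w i (σE i) + θE * g i (σE i)))
    (hZ : (∀ i, ok i (σZ i)) ∧ ∀ τ : Equiv.Perm V, τ ≠ σZ → (∀ i, ok i (τ i)) →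
      ∑ i, (w i (τ i) + θZ * g i (τ i)) < ∑ i, (w i (σZ i) + θZ * g i (σZ i)))
    (hC0 : σC (b 0) ≠ b 0) (hC1 : σC (b 1) = b 1) (hC2 : σC (b 2) ≠ b 2) (hC3 : σC (b 3) = b 3) (hC4 : σC (b 4) ≠ b 4)
    (hE0 : σE (b 0) ≠ b 0) (hE1 : σE (b 1) ≠ b 1) (hE2 : σE (b 2) = b 2) (hE3 : σE (b 3) = b 3) (hE4 : σE (b 4) ≠ b 4)
    (hZ0 : σZ (b 0) = b 0) (hZ1 : σZ (b 1) ≠ b 1) (hZ2 : σZ (b 2) ≠ b 2) (hZ3 : σZ (b 3) ≠ b 3) (hZ4 : σZ (b 4) = b 4)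
    (T : Equiv.Perm V) (hT : ∀ i, T i = σC i ∨ T i = σE i ∨ T i = σZ i) (hT4 : T (b 4) = b 4) (hT0 : T (b 0) ≠ b 0) :
    T (b 1) ≠ b 1 ∧ T (b 2) ≠ b 2 ∧ T (b 3) ≠ b 3 := by
  suffices hnot : ¬ (T (b 1) = b 1 ∨ T (b 2) = b 2 ∨ T (b 3) = b 3) by
    exact ⟨fun h => hnot (Or.inl h), fun h => hnot (Or.inr (Or.inl h)), fun h => hnot (Or.inr (Or.inr h))⟩
  intro hfix
  obtain ⟨M₂, M₃, hP⟩ := FourBit.two_factor σC σE σZ T hT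
  have sC := slope_C g b hb hoff hmark haux σC hC0 hC1 hC2 hC3 hC4
  have sZ := slope_Z g b hb hoff hmark haux σZ hZ0 hZ1 hZ2 hZ3 hZ4
  have hhi : (∑ i, g i (σZ i)) ≤ ∑ i, g i (T i) := by
    rw [sZ]; exact seventeen_le_slope_of_four g b hb hoff hmark haux T hT4 hfix
  obtain ⟨n24, n34⟩ := not_fix_of_perm (hP (b 4)) hT4 hC4 hE4 hZ4
  -- multiplicities outside: b0 once, b1 once (σC), b2 once (σE), b3 twice
  have x0 := excl_of_count_le_one (v := b 0) (hP (b 0)) (by simp [hC0, hE0, hZ0])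
  have x1 := excl_of_count_le_one (v := b 1) (hP (b 1)) (by simp [hC1, hE1, hZ1])
  have x2 := excl_of_count_le_one (v := b 2) (hP (b 2)) (by simp [hC2, hE2, hZ2])
  have x3 := not_all_of_count_le_two (v := b 3) (hP (b 3)) (by simp [hC3, hE3, hZ3])
  have hlow : (∑ i, g i (M₂ i)) ≤ 10 ∨ (∑ i, g i (M₃ i)) ≤ 10 := by
    by_contra hcon
    push Not at hcon
    obtain ⟨m23, h2⟩ := shape_of_slope_gt_ten g b hb hoff hmark haux M₂ n24 hcon.1
    obtain ⟨m33, h3⟩ := shape_of_slope_gt_ten g b hb hoff hmark haux M₃ n34 hcon.2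
    rcases hfix with t1 | t2 | t3
    · -- `T` uses `b1` (once available): the `M`'s need `b2`, available once
      have m21 : M₂ (b 1) ≠ b 1 := (x1.1 t1).1
      have m31 : M₃ (b 1) ≠ b 1 := (x1.1 t1).2
      have m22 : M₂ (b 2) = b 2 := by rcases h2 with h | ⟨h, -⟩; exacts [h, absurd h m21]
      have m32 : M₃ (b 2) = b 2 := by rcases h3 with h | ⟨h, -⟩; exacts [h, absurd h m31]
      exact x2.2 m22 m32
    · -- `T` uses `b2`: the `M`'s need `b1` and `b0`, the latter available once
      have m22 : M₂ (b 2) ≠ b 2 := (x2.1 t2).1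
      have m32 : M₃ (b 2) ≠ b 2 := (x2.1 t2).2
      have m20 : M₂ (b 0) = b 0 := by rcases h2 with h | ⟨-, h⟩; exacts [absurd h m22, h]
      have m30 : M₃ (b 0) = b 0 := by rcases h3 with h | ⟨-, h⟩; exacts [absurd h m32, h]
      exact x0.2 m20 m30
    · -- `T` uses `b3`: three users of a loop available twice
      exact x3 ⟨t3, m23, m33⟩
  rcases hlow with h2 | h3
  · have hlo : (∑ i, g i (M₂ i)) ≤ ∑ i, g i (σC i) := by rw [sC]; exact h2
    have := (FourBit.factors_eq ok w g hCE hEZ hC hE hZ (fun i => perm_rotate (hP i)) hlo hhi).2.2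
    exact hT0 (by rw [this]; exact hZ0)
  · have hlo : (∑ i, g i (M₃ i)) ≤ ∑ i, g i (σC i) := by rw [sC]; exact h3
    have := (FourBit.factors_eq ok w g hCE hEZ hC hE hZ (fun i => perm_rotate' (hP i)) hlo hhi).2.2
    exact hT0 (by rw [this]; exact hZ0)

/-- **b4-RIGIDITY in `σB ⊎ σE ⊎ σZ`.**  A cover inside the arcs of `σB, σE, σZ` using the loop at `b4` but not at `b0` uses neither `b1` nor
`b3`. [this seat's lemma] -/
theorem core_BEZ_four (hb : Function.Injective b)
    (hoff : ∀ i j, j ≠ i → g i j = 0) (hmark : ∀ l, g (b l) (b l) = (2 : ℤ) ^ (l : ℕ)) (haux : ∀ i, (∀ l, b l ≠ i) → g i i = 0)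
    {θB θE θZ : ℤ} {σB σE σZ : Equiv.Perm V} (hBE : θB < θE) (hEZ : θE < θZ)
    (hB : (∀ i, ok i (σB i)) ∧ ∀ τ : Equiv.Perm V, τ ≠ σB → (∀ i, ok i (τ i)) →
      ∑ i, (w i (τ i) + θB * g i (τ i)) < ∑ i, (w i (σB i) + θB * g i (σB i)))
    (hE : (∀ i, ok i (σE i)) ∧ ∀ τ : Equiv.Perm V, τ ≠ σE → (∀ i, ok i (τ i)) →
      ∑ i, (w i (τ i) + θE * g i (τ i)) < ∑ i, (w i (σE i) + θE * g i (σE i)))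
    (hZ : (∀ i, ok i (σZ i)) ∧ ∀ τ : Equiv.Perm V, τ ≠ σZ → (∀ i, ok i (τ i)) →
      ∑ i, (w i (τ i) + θZ * g i (τ i)) < ∑ i, (w i (σZ i) + θZ * g i (σZ i)))
    (hB0 : σB (b 0) ≠ b 0) (hB1 : σB (b 1) = b 1) (hB2 : σB (b 2) = b 2) (hB3 : σB (b 3) ≠ b 3) (hB4 : σB (b 4) ≠ b 4)
    (hE0 : σE (b 0) ≠ b 0) (hE1 : σE (b 1) ≠ b 1) (hE3 : σE (b 3) = b 3) (hE4 : σE (b 4) ≠ b 4)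
    (hZ0 : σZ (b 0) = b 0) (hZ1 : σZ (b 1) ≠ b 1) (hZ2 : σZ (b 2) ≠ b 2) (hZ3 : σZ (b 3) ≠ b 3) (hZ4 : σZ (b 4) = b 4)
    (T : Equiv.Perm V) (hT : ∀ i, T i = σB i ∨ T i = σE i ∨ T i = σZ i) (hT4 : T (b 4) = b 4) (hT0 : T (b 0) ≠ b 0) :
    T (b 1) ≠ b 1 ∧ T (b 3) ≠ b 3 := by
  suffices hnot : ¬ (T (b 1) = b 1 ∨ T (b 3) = b 3) by exact ⟨fun h => hnot (Or.inl h), fun h => hnot (Or.inr h)⟩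
  intro hfix
  obtain ⟨M₂, M₃, hP⟩ := FourBit.two_factor σB σE σZ T hT
  have sB := slope_B g b hb hoff hmark haux σB hB0 hB1 hB2 hB3 hB4
  have sZ := slope_Z g b hb hoff hmark haux σZ hZ0 hZ1 hZ2 hZ3 hZ4
  have hhi : (∑ i, g i (σZ i)) ≤ ∑ i, g i (T i) := by
    rw [sZ]
    refine seventeen_le_slope_of_four g b hb hoff hmark haux T hT4 ?_
    rcases hfix with h | h; exacts [Or.inl h, Or.inr (Or.inr h)]
  obtain ⟨n24, n34⟩ := not_fix_of_perm (hP (b 4)) hT4 hB4 hE4 hZ4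
  have x0 := excl_of_count_le_one (v := b 0) (hP (b 0)) (by simp [hB0, hE0, hZ0])
  have x1 := excl_of_count_le_one (v := b 1) (hP (b 1)) (by simp [hB1, hE1, hZ1])
  have x3 := excl_of_count_le_one (v := b 3) (hP (b 3)) (by simp [hB3, hE3, hZ3])
  have hlow : (∑ i, g i (M₂ i)) ≤ 6 ∨ (∑ i, g i (M₃ i)) ≤ 6 := by
    by_contra hcon
    push Not at hcon
    have h2 := shape_of_slope_gt_six g b hb hoff hmark haux M₂ n24 hcon.1
    have h3 := shape_of_slope_gt_six g b hb hoff hmark haux M₃ n34 hcon.2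
    rcases hfix with t1 | t3
    · -- `T` uses `b1` (available once): both `M`'s need `b3`, available once
      have m23 : M₂ (b 3) = b 3 := by rcases h2 with h | ⟨-, h, -⟩; exacts [h, absurd h (x1.1 t1).1]
      have m33 : M₃ (b 3) = b 3 := by rcases h3 with h | ⟨-, h, -⟩; exacts [h, absurd h (x1.1 t1).2]
      exact x3.2 m23 m33
    · -- `T` uses `b3` (available once): both `M`'s need `b0`, available once
      have m20 : M₂ (b 0) = b 0 := by rcases h2 with h | ⟨h, -, -⟩; exacts [absurd h (x3.1 t3).1, h]
      have m30 : M₃ (b 0) = b 0 := by rcases h3 with h | ⟨h, -, -⟩; exacts [absurd h (x3.1 t3).2, h]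
      exact x0.2 m20 m30
  rcases hlow with h2 | h3
  · have hlo : (∑ i, g i (M₂ i)) ≤ ∑ i, g i (σB i) := by rw [sB]; exact h2
    have := (FourBit.factors_eq ok w g hBE hEZ hB hE hZ (fun i => perm_rotate (hP i)) hlo hhi).2.2
    exact hT0 (by rw [this]; exact hZ0)
  · have hlo : (∑ i, g i (M₃ i)) ≤ ∑ i, g i (σB i) := by rw [sB]; exact h3
    have := (FourBit.factors_eq ok w g hBE hEZ hB hE hZ (fun i => perm_rotate' (hP i)) hlo hhi).2.2
    exact hT0 (by rw [this]; exact hZ0)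

/-- **b4-RIGIDITY in `σB ⊎ σC ⊎ σZ`.**  A cover inside the arcs of `σB, σC, σZ` using the loop at `b4` but not at `b0` uses neither `b2` nor
`b3`. [this seat's lemma] -/
theorem core_BCZ_four (hb : Function.Injective b)
    (hoff : ∀ i j, j ≠ i → g i j = 0) (hmark : ∀ l, g (b l) (b l) = (2 : ℤ) ^ (l : ℕ)) (haux : ∀ i, (∀ l, b l ≠ i) → g i i = 0)
    {θB θC θZ : ℤ} {σB σC σZ : Equiv.Perm V} (hBC : θB < θC) (hCZ : θC < θZ)
    (hB : (∀ i, ok i (σB i)) ∧ ∀ τ : Equiv.Perm V, τ ≠ σB → (∀ i, ok i (τ i)) →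
      ∑ i, (w i (τ i) + θB * g i (τ i)) < ∑ i, (w i (σB i) + θB * g i (σB i)))
    (hC : (∀ i, ok i (σC i)) ∧ ∀ τ : Equiv.Perm V, τ ≠ σC → (∀ i, ok i (τ i)) →
      ∑ i, (w i (τ i) + θC * g i (τ i)) < ∑ i, (w i (σC i) + θC * g i (σC i)))
    (hZ : (∀ i, ok i (σZ i)) ∧ ∀ τ : Equiv.Perm V, τ ≠ σZ → (∀ i, ok i (τ i)) →
      ∑ i, (w i (τ i) + θZ * g i (τ i)) < ∑ i, (w i (σZ i) + θZ * g i (σZ i)))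
    (hB0 : σB (b 0) ≠ b 0) (hB1 : σB (b 1) = b 1) (hB2 : σB (b 2) = b 2) (hB3 : σB (b 3) ≠ b 3) (hB4 : σB (b 4) ≠ b 4)
    (hC0 : σC (b 0) ≠ b 0) (hC2 : σC (b 2) ≠ b 2) (hC3 : σC (b 3) = b 3) (hC4 : σC (b 4) ≠ b 4)
    (hZ0 : σZ (b 0) = b 0) (hZ1 : σZ (b 1) ≠ b 1) (hZ2 : σZ (b 2) ≠ b 2) (hZ3 : σZ (b 3) ≠ b 3) (hZ4 : σZ (b 4) = b 4)
    (T : Equiv.Perm V) (hT : ∀ i, T i = σB i ∨ T i = σC i ∨ T i = σZ i) (hT4 : T (b 4) = b 4) (hT0 : T (b 0) ≠ b 0) :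
    T (b 2) ≠ b 2 ∧ T (b 3) ≠ b 3 := by
  suffices hnot : ¬ (T (b 2) = b 2 ∨ T (b 3) = b 3) by exact ⟨fun h => hnot (Or.inl h), fun h => hnot (Or.inr h)⟩
  intro hfix
  obtain ⟨M₂, M₃, hP⟩ := FourBit.two_factor σB σC σZ T hT
  have sB := slope_B g b hb hoff hmark haux σB hB0 hB1 hB2 hB3 hB4
  have sZ := slope_Z g b hb hoff hmark haux σZ hZ0 hZ1 hZ2 hZ3 hZ4
  have hhi : (∑ i, g i (σZ i)) ≤ ∑ i, g i (T i) := by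
    rw [sZ]; exact seventeen_le_slope_of_four g b hb hoff hmark haux T hT4 (Or.inr hfix)
  obtain ⟨n24, n34⟩ := not_fix_of_perm (hP (b 4)) hT4 hB4 hC4 hZ4
  have x0 := excl_of_count_le_one (v := b 0) (hP (b 0)) (by simp [hB0, hC0, hZ0])
  have x2 := excl_of_count_le_one (v := b 2) (hP (b 2)) (by simp [hB2, hC2, hZ2])
  have x3 := excl_of_count_le_one (v := b 3) (hP (b 3)) (by simp [hB3, hC3, hZ3])
  have hlow : (∑ i, g i (M₂ i)) ≤ 6 ∨ (∑ i, g i (M₃ i)) ≤ 6 := by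
    by_contra hcon
    push Not at hcon
    have h2 := shape_of_slope_gt_six g b hb hoff hmark haux M₂ n24 hcon.1
    have h3 := shape_of_slope_gt_six g b hb hoff hmark haux M₃ n34 hcon.2
    rcases hfix with t2 | t3
    · -- `T` uses `b2` (available once): both `M`'s need `b3`, available once
      have m23 : M₂ (b 3) = b 3 := by rcases h2 with h | ⟨-, -, h⟩; exacts [h, absurd h (x2.1 t2).1]
      have m33 : M₃ (b 3) = b 3 := by rcases h3 with h | ⟨-, -, h⟩; exacts [h, absurd h (x2.1 t2).2]
      exact x3.2 m23 m33
    · -- `T` uses `b3` (available once): both `M`'s need `b0`, available once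
      have m20 : M₂ (b 0) = b 0 := by rcases h2 with h | ⟨h, -, -⟩; exacts [absurd h (x3.1 t3).1, h]
      have m30 : M₃ (b 0) = b 0 := by rcases h3 with h | ⟨h, -, -⟩; exacts [absurd h (x3.1 t3).2, h]
      exact x0.2 m20 m30
  rcases hlow with h2 | h3
  · have hlo : (∑ i, g i (M₂ i)) ≤ ∑ i, g i (σB i) := by rw [sB]; exact h2
    have := (FourBit.factors_eq ok w g hBC hCZ hB hC hZ (fun i => perm_rotate (hP i)) hlo hhi).2.2
    exact hT0 (by rw [this]; exact hZ0)
  · have hlo : (∑ i, g i (M₃ i)) ≤ ∑ i, g i (σB i) := by rw [sB]; exact h3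
    have := (FourBit.factors_eq ok w g hBC hCZ hB hC hZ (fun i => perm_rotate' (hP i)) hlo hhi).2.2
    exact hT0 (by rw [this]; exact hZ0)

end Core

end Core
end MarkedEdge
end Summit.ValiantsHypothesis.ValiantsHypothesis.Theorems.KPlusLogSqLaw
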